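/-
Copyright: lit-balaban cell, Phase-2 proof seat p33 (gen 6).  Statement-level skeleton of a published paper; no proof claims beyond
what the kernel checks below.
-/
import Literature.MathematicalPhysics.QuantumFieldTheory.BalabanImbrieJaffe1984to88.BIJ85BlockAveragesTorusK

/-!
# `BalabanImbrieJaffe1984to88.BIJ85HolonomyDeviation` — T. Bałaban, J. Imbrie, A. Jaffe, *Renormalization of the Higgs model:
minimizers, propagators and the stability of mean field theory*, Commun. Math. Phys. **97** (1985) 299–329
[BalabanImbrieJaffe1985]: the elementary DEVIATION-FROM-UNITY bookkeeping of the `U(1)` transports (2.5) along the contours of Sect. 2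
/ (5.1.2)–(5.1.3) on the torus carriers of record — if every bond variable satisfies `|u_b − 1| ≤ T` then `|u(run of n bonds) − 1| ≤ nT`,
`|u^{(k)}(b) − 1| ≤ L^kT` for the iterated run transports, `|u(Γ_{yx}) − 1| ≤ d(L−1)T` and `|u(Γ^{(k)}_{x_k,x}) − 1| ≤ d(L^k−1)T` for the
(composite) tree transports; and the transports of a bondwise PRODUCT of two `U(1)` fields are the products of the transports (the
abelian group `U(1)`).  Kernel plumbing for the scalar stability estimate (7.3.2) p. 326 at the background (4.5.4)
`u_k = Q^{s*}_k v · exp[−ie_kη(𝒟_k∂^*Q^{e*}_kf^{(k)})]` (companion of this seat's `BIJ85Ineq732PullBack`, p262642): there the second factor is a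
bondwise phase `|e^{−ie_kηX_b} − 1| ≤ e_kη|X_b|`, and these bounds control the holonomy defects of p11's covariant block-averaging inequality
`BIJ85BlockAveragingIneqCov`.

statement-level skeleton of published theorems with citation tags; proofs where landed; nothing here is a claim about the Yang–Mills mass gap

PDF held: `paper:balaban1985-cmp97-bij-higgs-minimizers` (journal page = PDF page + 298).  Pages read (`lit read`, OCR text): p. 302–303
[PDF 4–5] ((2.4)–(2.6), (2.10)), p. 313 [PDF 15] ((4.5.4), (5.1.2)–(5.1.3)), p. 326 [PDF 28] ((7.3.1)–(7.3.2)).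

CITATION HEADER (lean-in-tree rule).  Phase-2 file of the lit-balaban TYPED SKELETON (HOME `run/shared/lean/pub/lit-balaban/`), seat p33 gen 6
(unit `lit-balaban-p33-g6`; TAKING line HOME/STATUS.md 2026-08-21T10:38:53Z; owner r15, referee ref-5), in support of SKELETON row
**C1.Eq7.3.1-7.3.2** (GAPS G-C1-05: the general background).  Theorems only, about r18's/p11's objects BY NAME (`runProd`, `lineU`, `lineIter`,
`legProd`, `holC`, `holCK`, `expU1`, `toC`); nothing is re-declared, no definition, no named fact.

THE PRINTED TEXT, verbatim.  p. 302 [PDF 4]: *"define u(Γ) = Π_{b∈Γ} u_b. (2.5) Contours Γ₁, Γ₂ can be composed if the endpoint of Γ₂ coincides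
with the starting point of Γ₁, so u(Γ₁∘Γ₂) = u(Γ₁)u(Γ₂)."*  p. 313 [PDF 15]: *"(u_k)_b = (Q^{s*}_kv)_b exp[−ie_kη(𝒟_k∂^*Q^{e*}_kf^{(k)})_b]. (4.5.4)
… The contour Γ_{x_k,x} runs from x to x₁ in B(x₁), from x₁ to x₂ in B(x₂), etc."*  p. 326 [PDF 28]: *"|v(∂p) − 1| ≤ e_k𝓅(e_k), (7.3.1)"*.

WHAT IS PROVED (0 `sorry`, standard axioms; all `U(1)` products read in `ℂ` through `toC`):
* §1 unit-modulus algebra: `|ab − 1| ≤ |a − 1| + |b − 1|` (`|a| = 1`), `|a⁻¹ − 1| = |a − 1|`, `|Π_i a_i − 1| ≤ Σ_i |a_i − 1|`;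
  `|toC(e^{iθ}) − 1| ≤ |θ|` (Mathlib `Real.norm_exp_I_mul_ofReal_sub_one_le`).
* §2 MULTIPLICATIVITY along contours for the bondwise product `b ↦ u_b·w_b` of two `U(1)` fields (commutativity of `U(1)` through `toC`):
  `runProd`, `lineU`, `lineIter`, `holC`, `holCK` of the product = the products (`runProd_mul`, `lineIter_mul`, `holC_mul`, `holCK_mul`).
* §3 DEVIATION BOUNDS: if `|u_b − 1| ≤ T` on every bond then `|u(run_{x,μ,n}) − 1| ≤ nT` (`norm_runProd_sub_one_le`), `|u^{(k)}(b) − 1| ≤ L^kT`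
  (`norm_lineIter_sub_one_le`), `|u(Γ_{yx}) − 1| ≤ d(L−1)T` (`norm_holC_sub_one_le`), **`|u(Γ^{(k)}_{x_k,x}) − 1| ≤ d(L^k − 1)T`**
  (`norm_holCK_sub_one_le`; the composite contour has at most `d(L^k − 1)` bonds).
HONEST SCOPE.  Elementary bookkeeping (triangle inequalities); it proves nothing of Sect. 7.3 by itself.
-/

open scoped BigOperators
open Finset Complex

namespace Literature.MathematicalPhysics.QuantumFieldTheory.BalabanImbrieJaffe1984to88.BIJ85HolonomyDeviation

open Literature.MathematicalPhysics.QuantumFieldTheory.Balaban1983to89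
open BIJ88Sect3Statements (U1 toC norm_toC toC_one toC_mul)
open BIJ88Sect3Rescaling (toC_injective_U1)
open BIJ88RenormTransf311 (inBlock)
open BIJ85BlockAveragesTorus BIJ85BlockAveragesTorusK

noncomputable section

variable {P : Params} {j : ℕ}

/-! ## §1 Unit-modulus algebra -/

/-- kernel (unit-modulus bookkeeping behind (7.3.1) `|v(∂p) − 1| ≤ …` and the composition rule `u(Γ₁∘Γ₂) = u(Γ₁)u(Γ₂)` of (2.5)):
`|ab − 1| ≤ |a||b − 1| + |a − 1|` (`ab − 1 = a(b − 1) + (a − 1)`; used with `|a| = 1`). [cite: BalabanImbrieJaffe1985, (2.5) p.302, (7.3.1) p.326] -/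
theorem norm_mul_sub_one_le (a b : ℂ) : ‖a * b - 1‖ ≤ ‖a‖ * ‖b - 1‖ + ‖a - 1‖ := by
  have e : a * b - 1 = a * (b - 1) + (a - 1) := by ring
  rw [e, ← norm_mul]
  exact norm_add_le _ _

/-- kernel (unit-modulus bookkeeping behind (7.3.1), reversed contours in (2.5)): `|a⁻¹ − 1| = |a − 1|` for `|a| = 1`
(`a⁻¹ − 1 = −a⁻¹(a − 1)`). [cite: BalabanImbrieJaffe1985, (2.5) p.302, (7.3.1) p.326] -/
theorem norm_inv_sub_one {a : ℂ} (ha : ‖a‖ = 1) : ‖a⁻¹ - 1‖ = ‖a - 1‖ := by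
  have hne : a ≠ 0 := fun h => by simp [h] at ha
  have e : a⁻¹ - 1 = -(a⁻¹ * (a - 1)) := by field_simp; ring
  rw [e, norm_neg, norm_mul, norm_inv, ha, inv_one, one_mul]

/-- kernel (unit-modulus bookkeeping behind (7.3.1) for the contour products `u(Γ) = Π_{b∈Γ} u_b` of (2.5)):
`|Π_{i∈s} a_i − 1| ≤ Σ_{i∈s} |a_i − 1|` for unit-modulus factors. [cite: BalabanImbrieJaffe1985, (2.5) p.302, (7.3.1) p.326] -/
theorem norm_prod_sub_one_le {ι : Type*} (s : Finset ι) (f : ι → ℂ) (hf : ∀ i ∈ s, ‖f i‖ = 1) :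
    ‖∏ i ∈ s, f i - 1‖ ≤ ∑ i ∈ s, ‖f i - 1‖ := by
  classical
  induction s using Finset.induction_on with
  | empty => simp
  | insert i s hi ih =>
    rw [prod_insert hi, sum_insert hi, mul_comm]
    have hs : ∀ i' ∈ s, ‖f i'‖ = 1 := fun i' hi' => hf i' (mem_insert_of_mem hi')
    have h1 : ‖∏ i' ∈ s, f i'‖ = 1 := by rw [norm_prod]; exact prod_eq_one fun i' hi' => hs i' hi'
    refine (norm_mul_sub_one_le _ _).trans ?_
    rw [h1, one_mul]
    exact add_le_add le_rfl (ih hs)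

/-- kernel: a bondwise phase `e^{iθ}` deviates from `1` by at most `|θ|` (`|e^{iθ} − 1| = 2|sin(θ/2)| ≤ |θ|`; r18's `expU1`).
[cite: BalabanImbrieJaffe1985, (4.5.4) p.313] -/
theorem norm_toC_expU1_sub_one_le (θ : ℝ) : ‖toC (expU1 θ) - 1‖ ≤ |θ| := by
  rw [toC_expU1, mul_comm]
  have h := (Real.norm_exp_I_mul_ofReal_sub_one_le (x := θ))
  rwa [Real.norm_eq_abs] at h

/-! ## §2 Multiplicativity of the transports for bondwise products (`U(1)` is abelian) -/

/-- kernel: the structure group `G = U(1)` of the model ((2.5): `u_b ∈ G = U(1)`), typed as `1 × 1` unitary matrices, is commutative —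
read in `ℂ` through `toC`. [cite: BalabanImbrieJaffe1985, (2.5) p.302] -/
theorem U1_mul_comm (g h : U1) : g * h = h * g :=
  toC_injective_U1 (by rw [toC_mul, toC_mul, mul_comm])

/-- kernel: the run transport (2.5) of a bondwise product is the product of the run transports. [cite: BalabanImbrieJaffe1985, (2.5) p.302] -/
theorem runProd_mul (U V : GaugeField P j U1) (x : Balaban1983to89.Site P j) (μ : Fin P.d) (n : ℕ) :
    runProd (fun b => U b * V b) x μ n = runProd U x μ n * runProd V x μ n := by
  apply toC_injective_U1
  rw [toC_mul, toC_runProd, toC_runProd, toC_runProd, ← prod_mul_distrib]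
  exact prod_congr rfl fun t _ => toC_mul _ _

/-- kernel: `(uw)(Γ_{yy′}) = u(Γ_{yy′})w(Γ_{yy′})` for the `L`-lattice transports. [cite: BalabanImbrieJaffe1985, (2.5) p.302] -/
theorem lineU_mul (U V : GaugeField P j U1) : lineU (fun b => U b * V b) = fun c => lineU U c * lineU V c :=
  funext fun _ => runProd_mul U V _ _ _

/-- kernel: the iterated run transports (5.1.2)–(5.1.3) of a bondwise product are the products, `(uw)^{(k)} = u^{(k)}w^{(k)}`.
[cite: BalabanImbrieJaffe1985, (5.1.2)–(5.1.3) p.313] -/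
theorem lineIter_mul (U V : GaugeField P j U1) : ∀ k : ℕ, lineIter (fun b => U b * V b) k = fun c => lineIter U k c * lineIter V k c
  | 0 => rfl
  | k + 1 => by rw [lineIter_succ, lineIter_mul U V k, lineU_mul]; rfl

/-- kernel: `(uw)(Γ_{yx}) = u(Γ_{yx})w(Γ_{yx})` for the tree transports (2.6). [cite: BalabanImbrieJaffe1985, (2.5) p.302] -/
theorem holC_mul (U V : GaugeField P j U1) (z : Balaban1983to89.Site P j) : holC (fun b => U b * V b) z = holC U z * holC V z := by
  unfold holC legProd
  rw [← prod_mul_distrib]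
  refine prod_congr rfl fun μ _ => ?_
  rw [← prod_mul_distrib]
  exact prod_congr rfl fun t _ => toC_mul _ _

/-- kernel: `(uw)(Γ^{(k)}_{x_k,x}) = u(Γ^{(k)}_{x_k,x})w(Γ^{(k)}_{x_k,x})` for the composite transports (5.1.3). [cite: BalabanImbrieJaffe1985, (5.1.2)–(5.1.3) p.313] -/
theorem holCK_mul (U V : GaugeField P j U1) : ∀ (k : ℕ) (x : Balaban1983to89.Site P j),
    holCK (fun b => U b * V b) k x = holCK U k x * holCK V k x
  | 0, x => by rw [holCK_zero, holCK_zero, holCK_zero, mul_one]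
  | k + 1, x => by
    rw [holCK_succ, holCK_succ, holCK_succ, lineIter_mul, holC_mul, holCK_mul U V k x]
    ring

/-! ## §3 Deviation bounds: `|u_b − 1| ≤ T` on every bond propagates along runs, iterated runs and (composite) trees -/

/-- **`|u(run_{x,μ,n}) − 1| ≤ nT`** if `|u_b − 1| ≤ T` on every bond (the run transport (2.5)/(2.10) is a product of `n` bond variables).
[cite: BalabanImbrieJaffe1985, (2.10) p.303] -/
theorem norm_runProd_sub_one_le {U : GaugeField P j U1} {T : ℝ} (hU : ∀ b, ‖toC (U b) - 1‖ ≤ T) (x : Balaban1983to89.Site P j)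
    (μ : Fin P.d) (n : ℕ) : ‖toC (runProd U x μ n) - 1‖ ≤ n * T := by
  rw [toC_runProd]
  refine (norm_prod_sub_one_le _ _ fun t _ => norm_toC _).trans ?_
  calc ∑ t ∈ range n, ‖toC (U (runBond x μ t)) - 1‖ ≤ ∑ _t ∈ range n, T := sum_le_sum fun t _ => hU _
    _ = n * T := by rw [sum_const, card_range, nsmul_eq_mul]

/-- kernel: `|u(Γ_{yy′}) − 1| ≤ LT` for the `L`-lattice transports. [cite: BalabanImbrieJaffe1985, (2.10) p.303] -/
theorem norm_lineU_sub_one_le {U : GaugeField P j U1} {T : ℝ} (hU : ∀ b, ‖toC (U b) - 1‖ ≤ T) (c : PBond P (j + 1)) :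
    ‖toC (lineU U c) - 1‖ ≤ P.L * T :=
  norm_runProd_sub_one_le hU _ _ _

/-- **`|u^{(k)}(b) − 1| ≤ L^kT`** for the iterated run transports (5.1.2)–(5.1.3) if `|u_b − 1| ≤ T` on every bond.
[cite: BalabanImbrieJaffe1985, (5.1.2)–(5.1.3) p.313] -/
theorem norm_lineIter_sub_one_le {U : GaugeField P j U1} {T : ℝ} (hU : ∀ b, ‖toC (U b) - 1‖ ≤ T) :
    ∀ (k : ℕ) (c : PBond P (j + k)), ‖toC (lineIter U k c) - 1‖ ≤ (P.L : ℝ) ^ k * T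
  | 0, c => by rw [pow_zero, one_mul]; exact hU c
  | k + 1, c => by
    rw [lineIter_succ, pow_succ, mul_comm ((P.L : ℝ) ^ k), mul_assoc]
    exact norm_lineU_sub_one_le (fun c' => norm_lineIter_sub_one_le hU k c') c

/-- **`|u(Γ_{yx}) − 1| ≤ d(L−1)T`** for the tree transport (2.6) if `|u_b − 1| ≤ T` on every bond (the contour `Γ_{yx}` has `Σ_μ n_μ ≤ d(L−1)`
bonds). [cite: BalabanImbrieJaffe1985, (2.6) p.303] -/
theorem norm_holC_sub_one_le {U : GaugeField P j U1} {T : ℝ} (hT : 0 ≤ T) (hU : ∀ b, ‖toC (U b) - 1‖ ≤ T)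
    (z : Balaban1983to89.Site P j) : ‖holC U z - 1‖ ≤ P.d * ((P.L : ℝ) - 1) * T := by
  unfold holC
  have hleg : ∀ μ, ‖legProd U z μ - 1‖ ≤ ((P.L : ℝ) - 1) * T := fun μ => by
    unfold legProd
    refine (norm_prod_sub_one_le _ _ fun t _ => norm_toC _).trans ?_
    have hn : (inBlock z μ : ℝ) ≤ (P.L : ℝ) - 1 := by
      have h := Nat.mod_lt ((z μ).val) P.L_pos
      have h' : (inBlock z μ : ℝ) + 1 ≤ P.L := by
        unfold inBlock; exact_mod_cast h
      linarith
    calc ∑ t ∈ range (inBlock z μ), ‖toC (U (legBond z μ t)) - 1‖ ≤ ∑ _t ∈ range (inBlock z μ), T := sum_le_sum fun t _ => hU _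
      _ = (inBlock z μ : ℝ) * T := by rw [sum_const, card_range, nsmul_eq_mul]
      _ ≤ ((P.L : ℝ) - 1) * T := mul_le_mul_of_nonneg_right hn hT
  have hnorm : ∀ μ ∈ (univ : Finset (Fin P.d)), ‖legProd U z μ‖ = 1 := fun μ _ => by
    unfold legProd; rw [norm_prod]; exact prod_eq_one fun t _ => norm_toC _
  refine (norm_prod_sub_one_le _ _ hnorm).trans ?_
  calc ∑ μ : Fin P.d, ‖legProd U z μ - 1‖ ≤ ∑ _μ : Fin P.d, ((P.L : ℝ) - 1) * T := sum_le_sum fun μ _ => hleg μ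
    _ = P.d * ((P.L : ℝ) - 1) * T := by rw [sum_const, card_univ, Fintype.card_fin, nsmul_eq_mul, mul_assoc]

/-- **`|u(Γ^{(k)}_{x_k,x}) − 1| ≤ d(L^k − 1)T`** for the composite tree transport (5.1.3) if `|u_b − 1| ≤ T` on every bond: the segment at
level `i` contributes `d(L−1)·L^iT` (a tree of the `L^iη`-lattice whose bonds are runs of `L^i` bonds), and `Σ_{i<k} d(L−1)L^i = d(L^k − 1)`.
[cite: BalabanImbrieJaffe1985, (5.1.2)–(5.1.3) p.313] -/
theorem norm_holCK_sub_one_le {U : GaugeField P j U1} {T : ℝ} (hT : 0 ≤ T) (hU : ∀ b, ‖toC (U b) - 1‖ ≤ T) :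
    ∀ (k : ℕ) (x : Balaban1983to89.Site P j), ‖holCK U k x - 1‖ ≤ P.d * ((P.L : ℝ) ^ k - 1) * T
  | 0, x => by rw [holCK_zero, sub_self, norm_zero, pow_zero, sub_self, mul_zero, zero_mul]
  | k + 1, x => by
    rw [holCK_succ]
    have hLT : 0 ≤ (P.L : ℝ) ^ k * T := by positivity
    have h1 := norm_holC_sub_one_le hLT (fun c => norm_lineIter_sub_one_le hU k c) (blkIter k x)
    have h2 := norm_holCK_sub_one_le hT hU k x
    refine (norm_mul_sub_one_le _ _).trans ?_
    rw [norm_holC, one_mul]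
    refine (add_le_add h2 h1).trans (le_of_eq ?_)
    ring

end

end Literature.MathematicalPhysics.QuantumFieldTheory.BalabanImbrieJaffe1984to88.BIJ85HolonomyDeviation
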